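import Literature.NumberTheory.Transcendental.KZDilationStokesQuotient
import Literature.NumberTheory.Transcendental.KZCubeRational
import Literature.NumberTheory.Transcendental.KZSliceFubini
import Mathlib.MeasureTheory.Integral.IntervalIntegral.FundThmCalculus
import Mathlib.MeasureTheory.Integral.Prod
import HarnessLib

/-!
# Stokes descent for the dilation pencil, II: calculus on the cube (preparations)

Dilation functions `v_g(ϖ) = ∫_{[0,1]^n} g(ϖz) dz` (route `KontsevichZagierPeriods/LiftingCriteria`,
crux `DilationLiftAtOne`). For a rational potential `B = P/Q ∈ ℚ(x₀, x₁, …, x_d)` regular on an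
open box `(a,b)^{1+d} ⊇ [0,1]^{1+d}` and `h := ∂₀B`, the STOKES DESCENT identity holds on ALL of
`[0,1]` (next file, `KZDilationStokesDescent.lean`). This file holds the preparations: the cube
Fubini `[0,1]^{1+d} = [0,1] × [0,1]^d` with inner interval integral
(`setIntegral_cube_succ_interval`), box membership, the dilated FTC in the first variable
`∫₀¹ h(ϖt, w) dt = (B(ϖ,w) − B(0,w))/ϖ` (`integral_dilated_pderiv_zero`), the exact division
`(B(ϖ,w) − B(0,w))/ϖ = k(w) + (ϖ − 1)Ψ₁(ϖ,w)`, `k(w) = B(1,w) − B(0,w)`,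
`Ψ₁ = N₁/(Q·Q(0,·)·Q(1,·))` with `N₁` the Stokes quotient (`descent_pointwise`), and the value at
`ϖ = 0`, `h(0,w) = k(w) − Ψ₁(0,w)`, by differentiating `N = t(t−1)N₁` at `t = 0`
(`descent_at_zero`).

Everything is proved; no `def`, no named fact.

## References
* M. Kontsevich, D. Zagier, *Periods* (2001), §1.2 (Stokes as one of the three rules).
  [`KontsevichZagier2001`]
-/

noncomputable section

open Set MeasureTheory intervalIntegral
open scoped BigOperators Topology
open Literature.ModelTheory.ExponentialFields (IsSemialgebraic analyticOnNhd_aeval continuous_aeval_real)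

namespace Literature.NumberTheory.Transcendental

namespace KZ.StokesDescent

variable {d : ℕ}

/-! ### Cube integrals -/

/-- `∫_{[0,1]^d} c = c`. [folklore] -/
theorem setIntegral_cube_const (d : ℕ) (c : ℝ) :
    (∫ _z in Set.pi Set.univ (fun _ : Fin d => Icc (0:ℝ) 1), c) = c := by
  rw [setIntegral_const, Set.pi_univ_Icc, measureReal_def,
    Real.volume_Icc_pi_toReal (Pi.le_def.mpr fun _ => zero_le_one)]
  simp

/-- **Fubini over the first cube coordinate, inner interval integral.** For `F` integrable on
`[0,1]^{d+1}`: `∫_{[0,1]^{d+1}} F = ∫_{u ∈ [0,1]^d} ∫₀¹ F(vecCons t u) dt`. [folklore] -/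
theorem setIntegral_cube_succ_interval (F : (Fin (d + 1) → ℝ) → ℝ)
    (hF : IntegrableOn F (Set.pi Set.univ fun _ : Fin (d + 1) => Icc (0:ℝ) 1) volume) :
    (∫ z in Set.pi Set.univ (fun _ : Fin (d + 1) => Icc (0:ℝ) 1), F z) =
      ∫ u in Set.pi Set.univ (fun _ : Fin d => Icc (0:ℝ) 1), ∫ t in (0:ℝ)..1,
        F (Matrix.vecCons t u) := by
  have hpre : (fun p : ℝ × (Fin d → ℝ) => Matrix.vecCons p.1 p.2) ⁻¹'
      (Set.pi Set.univ fun _ : Fin (d + 1) => Icc (0:ℝ) 1) =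
      Icc (0:ℝ) 1 ×ˢ Set.pi Set.univ (fun _ : Fin d => Icc (0:ℝ) 1) := by
    ext p
    simp only [Set.mem_preimage, Set.mem_univ_pi, Fin.forall_fin_succ, Matrix.cons_val_zero,
      Matrix.cons_val_succ, Set.mem_prod]
  have hmp := (KZ.measurePreserving_vecCons (n := d))
  have hint : Integrable (fun p : ℝ × (Fin d → ℝ) => F (Matrix.vecCons p.1 p.2))
      (((volume : Measure ℝ).restrict (Icc (0:ℝ) 1)).prod
        ((volume : Measure (Fin d → ℝ)).restrict
          (Set.pi Set.univ fun _ : Fin d => Icc (0:ℝ) 1))) := by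
    have h := (hmp.integrableOn_comp_preimage KZ.measurableEmbedding_vecCons (f := F)
      (s := Set.pi Set.univ fun _ : Fin (d + 1) => Icc (0:ℝ) 1)).mpr hF
    rw [hpre] at h
    have h' := h.integrable
    rw [← Measure.prod_restrict] at h'
    exact h'
  rw [← hmp.setIntegral_preimage_emb KZ.measurableEmbedding_vecCons F
      (Set.pi Set.univ fun _ : Fin (d + 1) => Icc (0:ℝ) 1), hpre, ← Measure.prod_restrict,
    integral_prod_symm _ hint]
  refine setIntegral_congr_fun (MeasurableSet.univ_pi fun _ => measurableSet_Icc) fun u _ => ?_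
  simp only
  rw [integral_Icc_eq_integral_Ioc, intervalIntegral.integral_of_le zero_le_one]

/-! ### Boxes -/

/-- A dilated cube point prepended by a height in `[0,1]` lies in the box `(a,b)^{1+d}`.
[folklore] -/
theorem vecCons_mem_box {a b : ℝ} (ha : a < 0) (hb : 1 < b) {t : ℝ} (ht : t ∈ Icc (0:ℝ) 1)
    {w : Fin d → ℝ} (hw : w ∈ Set.pi Set.univ (fun _ : Fin d => Icc (0:ℝ) 1)) :
    Matrix.vecCons t w ∈ Set.pi Set.univ (fun _ : Fin (d + 1) => Ioo a b) := by
  rw [Set.mem_univ_pi]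
  refine Fin.cases ?_ (fun j => ?_)
  · simp only [Matrix.cons_val_zero]
    exact ⟨lt_of_lt_of_le ha ht.1, lt_of_le_of_lt ht.2 hb⟩
  · simp only [Matrix.cons_val_succ]
    have hj := (Set.mem_univ_pi.mp hw) j
    exact ⟨lt_of_lt_of_le ha hj.1, lt_of_le_of_lt hj.2 hb⟩

/-- Dilated cube points stay in the cube. [folklore] -/
theorem smul_mem_cube {ϖ : ℝ} (hϖ : ϖ ∈ Icc (0:ℝ) 1) {u : Fin d → ℝ}
    (hu : u ∈ Set.pi Set.univ (fun _ : Fin d => Icc (0:ℝ) 1)) :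
    ϖ • u ∈ Set.pi Set.univ (fun _ : Fin d => Icc (0:ℝ) 1) := by
  rw [Set.mem_univ_pi] at hu ⊢
  intro i
  simp only [Pi.smul_apply, smul_eq_mul]
  exact ⟨mul_nonneg hϖ.1 (hu i).1, mul_le_one₀ hϖ.2 (hu i).1 (hu i).2⟩

/-! ### FTC in the first variable -/

/-- **Dilated FTC in the first variable.** For `B = P/Q` regular on the box and `ϖ ∈ (0,1]`,
`w ∈ [0,1]^d`: `∫₀¹ (∂₀B)(ϖt, w) dt = (B(ϖ,w) − B(0,w))/ϖ`. [folklore] -/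
theorem integral_dilated_pderiv_zero {a b : ℝ} (ha : a < 0) (hb : 1 < b)
    (P Q : MvPolynomial (Fin (d + 1)) ℚ)
    (hQ : ∀ p ∈ Set.pi Set.univ (fun _ : Fin (d + 1) => Ioo a b), MvPolynomial.aeval p Q ≠ 0)
    {ϖ : ℝ} (hϖ : ϖ ∈ Ioc (0:ℝ) 1) {w : Fin d → ℝ}
    (hw : w ∈ Set.pi Set.univ (fun _ : Fin d => Icc (0:ℝ) 1)) :
    (∫ t in (0:ℝ)..1,
      (MvPolynomial.aeval (Matrix.vecCons (ϖ * t) w) (MvPolynomial.pderiv 0 P) *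
            MvPolynomial.aeval (Matrix.vecCons (ϖ * t) w) Q -
          MvPolynomial.aeval (Matrix.vecCons (ϖ * t) w) P *
            MvPolynomial.aeval (Matrix.vecCons (ϖ * t) w) (MvPolynomial.pderiv 0 Q)) /
        (MvPolynomial.aeval (Matrix.vecCons (ϖ * t) w) Q) ^ 2) =
      (MvPolynomial.aeval (Matrix.vecCons ϖ w) P / MvPolynomial.aeval (Matrix.vecCons ϖ w) Q -
        MvPolynomial.aeval (Matrix.vecCons 0 w) P / MvPolynomial.aeval (Matrix.vecCons 0 w) Q) / ϖ := by
  have hϖ0 : ϖ ≠ 0 := hϖ.1.ne'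
  -- points of the segment lie in the box
  have hmem : ∀ t ∈ Icc (0:ℝ) 1, Matrix.vecCons (ϖ * t) w ∈
      Set.pi Set.univ (fun _ : Fin (d + 1) => Ioo a b) := fun t ht =>
    vecCons_mem_box ha hb ⟨mul_nonneg hϖ.1.le ht.1, mul_le_one₀ hϖ.2 ht.1 ht.2⟩ hw
  have hupd : ∀ x : ℝ, Function.update (Matrix.vecCons (0:ℝ) w) 0 x = Matrix.vecCons x w :=
    fun x => Fin.update_cons_zero (α := fun _ : Fin (d + 1) => ℝ) (0:ℝ) w x
  -- the primitive `G t = B(ϖt, w)/ϖ`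
  have hderiv : ∀ t ∈ uIcc (0:ℝ) 1, HasDerivAt
      (fun t => MvPolynomial.aeval (Matrix.vecCons (ϖ * t) w) P /
        MvPolynomial.aeval (Matrix.vecCons (ϖ * t) w) Q / ϖ)
      ((MvPolynomial.aeval (Matrix.vecCons (ϖ * t) w) (MvPolynomial.pderiv 0 P) *
            MvPolynomial.aeval (Matrix.vecCons (ϖ * t) w) Q -
          MvPolynomial.aeval (Matrix.vecCons (ϖ * t) w) P *
            MvPolynomial.aeval (Matrix.vecCons (ϖ * t) w) (MvPolynomial.pderiv 0 Q)) /
        (MvPolynomial.aeval (Matrix.vecCons (ϖ * t) w) Q) ^ 2) t := by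
    intro t ht
    rw [uIcc_of_le zero_le_one] at ht
    have hQt : MvPolynomial.aeval (Function.update (Matrix.vecCons (0:ℝ) w) 0 (ϖ * t)) Q ≠ 0 := by
      rw [hupd]; exact hQ _ (hmem t ht)
    have hB := KZ.hasDerivAt_aeval_div_aeval_update P Q (Matrix.vecCons (0:ℝ) w) 0 (ϖ * t) hQt
    simp only [hupd] at hB
    have hlin : HasDerivAt (fun t : ℝ => ϖ * t) ϖ t := by
      simpa using (hasDerivAt_id t).const_mul ϖ
    have hcomp := hB.comp t hlin
    have hdiv := hcomp.div_const ϖ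
    refine hdiv.congr_deriv ?_
    field_simp
  have hcont : ContinuousOn (fun t : ℝ =>
      (MvPolynomial.aeval (Matrix.vecCons (ϖ * t) w) (MvPolynomial.pderiv 0 P) *
            MvPolynomial.aeval (Matrix.vecCons (ϖ * t) w) Q -
          MvPolynomial.aeval (Matrix.vecCons (ϖ * t) w) P *
            MvPolynomial.aeval (Matrix.vecCons (ϖ * t) w) (MvPolynomial.pderiv 0 Q)) /
        (MvPolynomial.aeval (Matrix.vecCons (ϖ * t) w) Q) ^ 2) (uIcc (0:ℝ) 1) := by
    rw [uIcc_of_le zero_le_one]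
    have hpath : Continuous fun t : ℝ => Matrix.vecCons (ϖ * t) w :=
      (continuous_const_mul ϖ).matrixVecCons continuous_const
    have hc : ∀ R : MvPolynomial (Fin (d + 1)) ℚ,
        Continuous fun t : ℝ => MvPolynomial.aeval (Matrix.vecCons (ϖ * t) w) R := fun R =>
      (continuous_aeval_real R).comp hpath
    refine (((hc _).mul (hc _)).sub ((hc _).mul (hc _))).continuousOn.div
      ((hc Q).pow 2).continuousOn fun t ht => pow_ne_zero _ (hQ _ (hmem t ht))
  rw [integral_eq_sub_of_hasDerivAt hderiv (hcont.intervalIntegrable)]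
  simp only [mul_one, mul_zero]
  ring

/-! ### The exact division -/

/-- **Pointwise descent identity (`ϖ ≠ 0`).** With `N₁` the Stokes quotient of `(P, Q)`:
`(B(ϖ,w) − B(0,w))/ϖ = (B(1,w) − B(0,w)) + (ϖ − 1)·N₁(ϖ,w)/(Q(ϖ,w)Q(0,w)Q(1,w))`. [folklore] -/
theorem descent_pointwise (P Q N₁ : MvPolynomial (Fin (d + 1)) ℚ)
    (hN : ∀ (t : ℝ) (u : Fin d → ℝ),
      (MvPolynomial.aeval (Fin.cons t u : Fin (d + 1) → ℝ) P *
            MvPolynomial.aeval (Fin.cons 0 u : Fin (d + 1) → ℝ) Q -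
          MvPolynomial.aeval (Fin.cons 0 u : Fin (d + 1) → ℝ) P *
            MvPolynomial.aeval (Fin.cons t u : Fin (d + 1) → ℝ) Q) *
          MvPolynomial.aeval (Fin.cons 1 u : Fin (d + 1) → ℝ) Q -
        t * (MvPolynomial.aeval (Fin.cons 1 u : Fin (d + 1) → ℝ) P *
              MvPolynomial.aeval (Fin.cons 0 u : Fin (d + 1) → ℝ) Q -
            MvPolynomial.aeval (Fin.cons 0 u : Fin (d + 1) → ℝ) P *
              MvPolynomial.aeval (Fin.cons 1 u : Fin (d + 1) → ℝ) Q) *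
          MvPolynomial.aeval (Fin.cons t u : Fin (d + 1) → ℝ) Q =
      t * (t - 1) * MvPolynomial.aeval (Fin.cons t u : Fin (d + 1) → ℝ) N₁)
    {ϖ : ℝ} (hϖ : ϖ ≠ 0) {w : Fin d → ℝ}
    (hQϖ : MvPolynomial.aeval (Matrix.vecCons ϖ w) Q ≠ 0)
    (hQ0 : MvPolynomial.aeval (Matrix.vecCons 0 w) Q ≠ 0)
    (hQ1 : MvPolynomial.aeval (Matrix.vecCons 1 w) Q ≠ 0) :
    (MvPolynomial.aeval (Matrix.vecCons ϖ w) P / MvPolynomial.aeval (Matrix.vecCons ϖ w) Q -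
        MvPolynomial.aeval (Matrix.vecCons 0 w) P / MvPolynomial.aeval (Matrix.vecCons 0 w) Q) / ϖ =
      (MvPolynomial.aeval (Matrix.vecCons 1 w) P / MvPolynomial.aeval (Matrix.vecCons 1 w) Q -
          MvPolynomial.aeval (Matrix.vecCons 0 w) P / MvPolynomial.aeval (Matrix.vecCons 0 w) Q) +
        (ϖ - 1) * (MvPolynomial.aeval (Matrix.vecCons ϖ w) N₁ /
          (MvPolynomial.aeval (Matrix.vecCons ϖ w) Q * MvPolynomial.aeval (Matrix.vecCons 0 w) Q *
            MvPolynomial.aeval (Matrix.vecCons 1 w) Q)) := by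
  have key := hN ϖ w
  simp only [Matrix.vecCons] at hQϖ hQ0 hQ1 ⊢
  field_simp
  linear_combination key

/-- **The value at `ϖ = 0`.** With `N₁` the Stokes quotient: `(∂₀B)(0,w) = (B(1,w) − B(0,w)) −
N₁(0,w)/(Q(0,w)²Q(1,w))` (differentiate `N = t(t−1)N₁` at `t = 0`). [folklore] -/
theorem descent_at_zero (P Q N₁ : MvPolynomial (Fin (d + 1)) ℚ)
    (hN : ∀ (t : ℝ) (u : Fin d → ℝ),
      (MvPolynomial.aeval (Fin.cons t u : Fin (d + 1) → ℝ) P *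
            MvPolynomial.aeval (Fin.cons 0 u : Fin (d + 1) → ℝ) Q -
          MvPolynomial.aeval (Fin.cons 0 u : Fin (d + 1) → ℝ) P *
            MvPolynomial.aeval (Fin.cons t u : Fin (d + 1) → ℝ) Q) *
          MvPolynomial.aeval (Fin.cons 1 u : Fin (d + 1) → ℝ) Q -
        t * (MvPolynomial.aeval (Fin.cons 1 u : Fin (d + 1) → ℝ) P *
              MvPolynomial.aeval (Fin.cons 0 u : Fin (d + 1) → ℝ) Q -
            MvPolynomial.aeval (Fin.cons 0 u : Fin (d + 1) → ℝ) P *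
              MvPolynomial.aeval (Fin.cons 1 u : Fin (d + 1) → ℝ) Q) *
          MvPolynomial.aeval (Fin.cons t u : Fin (d + 1) → ℝ) Q =
      t * (t - 1) * MvPolynomial.aeval (Fin.cons t u : Fin (d + 1) → ℝ) N₁)
    {w : Fin d → ℝ}
    (hQ0 : MvPolynomial.aeval (Matrix.vecCons 0 w) Q ≠ 0)
    (hQ1 : MvPolynomial.aeval (Matrix.vecCons 1 w) Q ≠ 0) :
    (MvPolynomial.aeval (Matrix.vecCons 0 w) (MvPolynomial.pderiv 0 P) *
          MvPolynomial.aeval (Matrix.vecCons 0 w) Q -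
        MvPolynomial.aeval (Matrix.vecCons 0 w) P *
          MvPolynomial.aeval (Matrix.vecCons 0 w) (MvPolynomial.pderiv 0 Q)) /
        (MvPolynomial.aeval (Matrix.vecCons 0 w) Q) ^ 2 =
      (MvPolynomial.aeval (Matrix.vecCons 1 w) P / MvPolynomial.aeval (Matrix.vecCons 1 w) Q -
          MvPolynomial.aeval (Matrix.vecCons 0 w) P / MvPolynomial.aeval (Matrix.vecCons 0 w) Q) -
        MvPolynomial.aeval (Matrix.vecCons 0 w) N₁ /
          (MvPolynomial.aeval (Matrix.vecCons 0 w) Q * MvPolynomial.aeval (Matrix.vecCons 0 w) Q *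
            MvPolynomial.aeval (Matrix.vecCons 1 w) Q) := by
  have hupd : ∀ x : ℝ, Function.update (Matrix.vecCons (0:ℝ) w) 0 x = Matrix.vecCons x w :=
    fun x => Fin.update_cons_zero (α := fun _ : Fin (d + 1) => ℝ) (0:ℝ) w x
  -- derivatives at `t = 0` of `t ↦ R(t, w)` for the polynomials involved
  have hD : ∀ R : MvPolynomial (Fin (d + 1)) ℚ, HasDerivAt
      (fun t : ℝ => MvPolynomial.aeval (Fin.cons t w : Fin (d + 1) → ℝ) R)
      (MvPolynomial.aeval (Fin.cons 0 w : Fin (d + 1) → ℝ) (MvPolynomial.pderiv 0 R)) 0 := by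
    intro R
    have h := KZ.hasDerivAt_aeval_update R (Matrix.vecCons (0:ℝ) w) 0 0
    simp only [hupd] at h
    exact h
  simp only [Matrix.vecCons] at hQ0 hQ1 ⊢
  -- abbreviations (values at the faces)
  set P0 : ℝ := MvPolynomial.aeval (Fin.cons 0 w : Fin (d + 1) → ℝ) P with hP0
  set P1 : ℝ := MvPolynomial.aeval (Fin.cons 1 w : Fin (d + 1) → ℝ) P with hP1
  set Q0 : ℝ := MvPolynomial.aeval (Fin.cons 0 w : Fin (d + 1) → ℝ) Q with hQ0'
  set Q1 : ℝ := MvPolynomial.aeval (Fin.cons 1 w : Fin (d + 1) → ℝ) Q with hQ1'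
  set P0' : ℝ := MvPolynomial.aeval (Fin.cons 0 w : Fin (d + 1) → ℝ) (MvPolynomial.pderiv 0 P)
    with hP0d
  set Q0' : ℝ := MvPolynomial.aeval (Fin.cons 0 w : Fin (d + 1) → ℝ) (MvPolynomial.pderiv 0 Q)
    with hQ0d
  set M0 : ℝ := MvPolynomial.aeval (Fin.cons 0 w : Fin (d + 1) → ℝ) N₁ with hM0
  -- derivative of the left-hand side `N(t, w)` at `t = 0`
  have hA : HasDerivAt (fun t : ℝ =>
      MvPolynomial.aeval (Fin.cons t w : Fin (d + 1) → ℝ) P * Q0 -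
        P0 * MvPolynomial.aeval (Fin.cons t w : Fin (d + 1) → ℝ) Q) (P0' * Q0 - P0 * Q0') 0 :=
    ((hD P).mul_const Q0).fun_sub ((hD Q).const_mul P0)
  have hL : HasDerivAt (fun t : ℝ =>
      (MvPolynomial.aeval (Fin.cons t w : Fin (d + 1) → ℝ) P * Q0 -
          P0 * MvPolynomial.aeval (Fin.cons t w : Fin (d + 1) → ℝ) Q) * Q1 -
        t * ((P1 * Q0 - P0 * Q1) * MvPolynomial.aeval (Fin.cons t w : Fin (d + 1) → ℝ) Q))
      ((P0' * Q0 - P0 * Q0') * Q1 - (1 * ((P1 * Q0 - P0 * Q1) * Q0) +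
        0 * ((P1 * Q0 - P0 * Q1) * Q0'))) 0 :=
    (hA.mul_const Q1).fun_sub ((hasDerivAt_id' (0:ℝ)).fun_mul ((hD Q).const_mul _))
  -- derivative of the right-hand side `t (t − 1) N₁(t, w)` at `t = 0`
  have h1 : HasDerivAt (fun t : ℝ => t * (t - 1)) (1 * ((0:ℝ) - 1) + 0 * 1) 0 :=
    (hasDerivAt_id' (0:ℝ)).fun_mul ((hasDerivAt_id' (0:ℝ)).sub_const 1)
  have hR : HasDerivAt (fun t : ℝ => t * (t - 1) *
      MvPolynomial.aeval (Fin.cons t w : Fin (d + 1) → ℝ) N₁)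
      ((1 * ((0:ℝ) - 1) + 0 * 1) * M0 + 0 * (0 - 1) *
        MvPolynomial.aeval (Fin.cons 0 w : Fin (d + 1) → ℝ) (MvPolynomial.pderiv 0 N₁)) 0 :=
    h1.fun_mul (hD N₁)
  -- the two functions coincide
  have hfun : (fun t : ℝ => t * (t - 1) *
      MvPolynomial.aeval (Fin.cons t w : Fin (d + 1) → ℝ) N₁) = fun t : ℝ =>
      (MvPolynomial.aeval (Fin.cons t w : Fin (d + 1) → ℝ) P * Q0 -
          P0 * MvPolynomial.aeval (Fin.cons t w : Fin (d + 1) → ℝ) Q) * Q1 -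
        t * ((P1 * Q0 - P0 * Q1) * MvPolynomial.aeval (Fin.cons t w : Fin (d + 1) → ℝ) Q) := by
    funext t
    rw [← mul_assoc, ← hN t w]
  rw [hfun] at hR
  have heq := hL.unique hR
  have hM : M0 = (P1 * Q0 - P0 * Q1) * Q0 - (P0' * Q0 - P0 * Q0') * Q1 := by linarith [heq]
  rw [hM]
  field_simp
  ring

end KZ.StokesDescent

end Literature.NumberTheory.Transcendental
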